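import Summits.QuantumFields.BalabanUV.Beta.FP.TowerDoorGaugeCopiesG
import Summits.QuantumFields.BalabanUV.Beta.FP.TowerDoorGaugePeriodised
import Summits.QuantumFields.BalabanUV.Beta.FP.TorusOneShotColumnGaugeProjG
import Summits.QuantumFields.BalabanUV.Beta.FP.NestedStepLawTorusCompositeOneShotTopSym
import Summits.QuantumFields.BalabanUV.Beta.FP.TorusCompositeSliceOneShot
import Summits.QuantumFields.BalabanUV.Beta.FP.RelInvPeriodisedEffFormCoarse

/-!
# `BalabanUV.Beta.FP.TowerDoorGaugePeriodisedG` — row D1 ∕ (C1) OWNER «beta-an2», PART 88, ROUTE T (β1), v11 (R-root): **PART 57 `TowerDoorGaugePeriodised` OVER `Q`, AND AT THE ROOTED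
# RECORD's PINS** — the door's tree-gauge function of a single top source is the `Mc`-periodisation of the lattice gauge function `lamZG Lc Q …`: §1 the copy-by-copy assembly over an abstract
# step-row family under (TB)(TQ) displayed (`hasSum_lamZG_treeGauge_readout`, `lv_smul_single_eq_tsum_lamZG` — PART 57 §4 line for line, PART 82's one-copy letter in place of road (C6)); §2
# **`lv_smul_single_eq_tsum_lamZG_at_pins_rooted`** — STUB P (P-c) AT v11's ROOTED PINS: PART 57's `…_at_pins` with `hQ₁₀ ∕ hQ₂₀` replaced by W-8 R-1's rooted texts (`compRows …`,
# `bhKStepAt 3 (toSite (ctrOff (3+1) Lc)) …`), everything else VERBATIM; inside, the gauge parameter's (D)-equation is road `nestedSlice_mul_gaugeParam_eq_neg` fed by road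
# `TorusOneShotColumnGaugeProjG.XN_toBlocks₁₂_mulVec_eq_gaugeProj_G` at the centred rooted family with the road's own v5-era rooted record (as `NestedKktEffNondegenerateRooted.h2_rec_rooted`
# feeds `_G`: `H₀_transpose_of_dvd` on the rooted re-spelling of `hH₀`, `torus_h1`, `hId_order_zero_record`, `det_nestedSlice_mul_towerGen_ne_zero`, `torus_isUnit_det_kkt_combRows`,
# `compRows_mul_towerGen_succ`, `torus_hTW_oneShot_tower`, `Qtop_mul_smul_tgrad_res`, `torus_a0_tower`), (TB)(TQ) by PART 80, the reference G-2 by PART 81 `det_refSliceG_ctr_mul_towerGen_ne_zero`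
# (β-function cell `pub-balaban`, BINDER-OWNERS row D1; FINDING AN2-82-1, road A-4 l.69064)

WHAT ([folklore] BY NAME; no `def`, no `def … : Prop`, nothing cited, 0 sorry): §0 `nestedSlice_ctr_eq_nestedSliceG` (leaf-06's identity for the centred family, structural induction);
§1 `hasSum_lamZG_treeGauge_readout`, `lv_smul_single_eq_tsum_lamZG` (generic `Q`, `hQ hQt` displayed); §2 `lv_smul_single_eq_tsum_lamZG_at_pins_rooted` (`d = 3`, the record chart
`scaleK σ σ (AN R (n+1))`, ROOTED pins; conclusion = PART 57's with `lamZ ↦ lamZG Lc (fun M _ ℓ _ => Qstep Lc M ℓ (ctrOff (3+1) Lc))`).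
WHAT THIS IS NOT: not PART 77′ (the END's `hlv` letter, which adds `h1` from the F leg and the `lamRecG` re-folding); nothing of v10 ∕ the END of record moves; nothing of Bałaban's asserted,
valued or discharged; 0 estimates; 0∕4 row-D1 binders (hW, hR, D1Tel, D1Rep); ROOT M‴ p325680 ∕ P5c ∕ D6 untouched; NOT (C1), NOT (T-ID), NOT D1, NEVER «G-an2-4 closed», NOT BetaPertH,
NOT continuum, NOT Clay.

HONEST DEPENDENCY (page 1, mandatory): continuum YM on T⁴ ⇐ BetaPertH ∧ nine spine estimates (0/9 proved); BetaPertH ⇐ (D1) ∧ (D4) ∧ CAP+tail;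
G-an2-4 gates asym, D1 and NE2/3/4.  HONEST FRAMING (cell contract, verbatim): «discharging `BetaPertH` makes Bałaban's UV stability UNCONDITIONAL —
a real constructive-QFT result; it is NOT the continuum limit and NOT the Clay problem.»  ABSOLUTE RULE (cell charter, verbatim): «No internally-minted
statement may enter as a cited fact. Every hypothesis is either kernel-proved in this package or a verbatim quotation of a PUBLISHED theorem with page
reference. The manuscript(s) under audit are NOT citable for their own disputed steps — they are the thing under adjudication; programme-internal
(2001/route/tribunal) claims are never citable.»  Row D1 ∕ (C1) OWNER «beta-an2», b2b-balaban-beta-an2 gen 82, 2026-08-29.  No existing file touched.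
-/

noncomputable section

open Finset Matrix
open scoped BigOperators
open Literature.Probability.LatticeModels (Torus.proj)
open Literature.MathematicalPhysics.QuantumFieldTheory
open Literature.MathematicalPhysics.QuantumFieldTheory.Balaban1983to89
open Literature.MathematicalPhysics.QuantumFieldTheory.Balaban1983to89.Beta
open Literature.MathematicalPhysics.QuantumFieldTheory.Balaban1983to89.Beta.Composition (kkt)
open Literature.MathematicalPhysics.QuantumFieldTheory.Balaban1983to89.Beta.CompositionSingular (effForm minOp)
open B4TorusKernel.MultiPeriod (translate translate_injective)
open B4Reflection242 (translate_translate)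
open B5Prop11Plancherel (fine)
open B6Lemma24Torus (pbox wrap)
open AffineAveraging (Site box toSite unitVec)
open AveragingContoursRooted (ctrOff ctrOff_mem_box)
open OneStepResolventKernel (Fib)
open ExpKernelCalculus (MKer shiftK)
open HessKerRate (scaleK scaleK_apply)
open Literature.MathematicalPhysics.QuantumFieldTheory.LatticeForm (quo)
open Summit.QuantumFields.BalabanUV.Beta.AxialDressingRooted (axEc)
open Summit.QuantumFields.BalabanUV.Beta.SymShiftedSpread (bhKStepSh)
open Summit.QuantumFields.BalabanUV.Beta.DshAn1 (Dsh)
open Summit.QuantumFields.BalabanUV.Beta.CompositeOneShotJetData (Roots AN AN_eq)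
open Summit.QuantumFields.BalabanUV.Beta.NVertexWoundPeriodised (shiftK_AN)
open Summit.QuantumFields.BalabanUV.Beta.FP.KernelPeriodisationFib (Idx perF perZ perF_apply perZ_apply)
open Summit.QuantumFields.BalabanUV.Beta.FP.TorusGaugeCovariancePairing (wrapPt wrapPt_coe)
open Summit.QuantumFields.BalabanUV.Beta.FP.TorusCombRows (Res)
open Summit.QuantumFields.BalabanUV.Beta.FP.TorusCompositeObjects (towerTorus towerTorus_apply NParam combF bigP towerGen bigRoot bigRatio bigRatio_eq_pow towerEquiv)
open Summit.QuantumFields.BalabanUV.Beta.FP.TorusCompositeObjectsG (StepRows compRowsG nestedSliceG nestedSliceG_succ compRows_eq_compRowsG nestedSlice_eq_nestedSliceG)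
open Summit.QuantumFields.BalabanUV.Beta.FP.TorusCompositeUnimodular (towerEvalC)
open Summit.QuantumFields.BalabanUV.Beta.GAN24.FineReadoutCauchyFrame (toSite_mem_range)
open Summit.QuantumFields.BalabanUV.Beta.FP.TowerK2bDoorReadoutPeriodised (wrap_eq_translate_neg_quo translate_smul_eq_smul_translate)
open Summit.QuantumFields.BalabanUV.Beta.FP.TowerDoorUniformDataTorus (summable_scaleK_AN_inl_inr_sources)
open Summit.QuantumFields.BalabanUV.Beta.FP.TorusWJunctionOfNLeg (leg12_of_hLN mask_apply_eq_of_hEA)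
open Summit.QuantumFields.BalabanUV.Beta.FP.TorusNestedGaugeReadout (nestedSlice_mul_gaugeParam_eq_neg)
open Summit.QuantumFields.BalabanUV.Beta.FP.TorusReferenceBlock (sub_zsmul_quo_mem_pbox_ref)
open Summit.QuantumFields.BalabanUV.Beta.FP.TowerDoorGaugeRefDefs (refCol refCol_apply)
open Summit.QuantumFields.BalabanUV.Beta.FP.TowerDoorGaugeRefDefsG

open Summit.QuantumFields.BalabanUV.Beta.FP.TowerDoorGaugeCopies
open Summit.QuantumFields.BalabanUV.Beta.FP.TowerDoorGaugeCopiesG (treeGauge_readout_eq_neg_lamZG)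
open Summit.QuantumFields.BalabanUV.Beta.FP.TowerDoorGaugePeriodised (shiftK_scaleK_AN summable_scaleK_AN_inl_inr_copies)
open Summit.QuantumFields.BalabanUV.Beta.FP.QstepCtrTwoBlock (QCtr_twoBlock QCtr_blockTranslate compRows_ctr_eq_compRowsG)
open Summit.QuantumFields.BalabanUV.Beta.FP.TorusCompositeObjects (Qstep compRows compRows_succ nestedSlice nestedSlice_succ)
open Summit.QuantumFields.BalabanUV.Beta.FP.TorusOneShotColumnGaugeProjG (XN_toBlocks₁₂_mulVec_eq_gaugeProj_G)
open Summit.QuantumFields.BalabanUV.Beta.FP.NestedStepLawTorusInstance (dvd_fine coarseSlot_injective coarseSlot_range torus_h1)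
open Summit.QuantumFields.BalabanUV.Beta.FP.NestedStepLawTorusComposite (H₀_transpose_of_dvd dvd_towerTorus_succ)
open Summit.QuantumFields.BalabanUV.Beta.FP.NestedStepLawTorusCompositeOneShot (torus_a0_tower)
open Summit.QuantumFields.BalabanUV.Beta.FP.NestedStepLawTorusCompositeOneShotTopSym (bhKStepSh_Dsh_inl_inl_eq_bhKStepAt)
open Summit.QuantumFields.BalabanUV.Beta.FP.TorusCompositeSlice (det_nestedSlice_mul_towerGen_ne_zero)
open Summit.QuantumFields.BalabanUV.Beta.FP.TorusCompositeSliceOneShot (torus_hTW_oneShot_tower)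
open Summit.QuantumFields.BalabanUV.Beta.FP.TorusCompositeCovariance (compRows_mul_towerGen_succ Qtop_mul_smul_tgrad_res)
open Summit.QuantumFields.BalabanUV.Beta.FP.RelInvPeriodisedCombRows (torus_isUnit_det_kkt_combRows)
open Summit.QuantumFields.BalabanUV.Beta.FP.RelInvPeriodisedEffFormCoarse (hId_order_zero_record)
open Summit.QuantumFields.BalabanUV.Beta.FP.TorusGaugeCovarianceCoarse (coarsePt coarsePt_coe)
open Summit.QuantumFields.BalabanUV.Beta.BorderedHessian (bhKStepAt stepScale)
open Summit.QuantumFields.BalabanUV.Beta.FP.TorusGaugeCovariance (tgrad)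

namespace Summit.QuantumFields.BalabanUV.Beta.FP.TowerDoorGaugePeriodisedG

variable {d : ℕ}

/-! ## §0 leaf-06's identity for the centred rooted family's nested slice -/

section Centred

variable (Lc : ℕ) [NeZero Lc]

/-- [folklore] **`nestedSlice = nestedSliceG` AT THE CENTRED ROOTED FAMILY** (record root list; structural induction as leaf-06 `nestedSlice_eq_nestedSliceG`, the composite rows by PART 80
`compRows_ctr_eq_compRowsG`). -/
theorem nestedSlice_ctr_eq_nestedSliceG : ∀ (M : Fin (d + 1) → ℕ) [∀ μ, NeZero (M μ)] (lev : ℕ → ℕ) (n : ℕ),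
    nestedSlice Lc M lev (fun _ : ℕ => ctrOff (d + 1) Lc) n
      = nestedSliceG Lc (fun (M : Fin (d + 1) → ℕ) (_ : ∀ μ, NeZero (M μ)) (ℓ : ℕ) (_ : Fin (d + 1) → ℕ) => Qstep Lc M ℓ (ctrOff (d + 1) Lc)) M lev
          (fun _ : ℕ => ctrOff (d + 1) Lc) n
  | M, _, lev, 0 => rfl
  | M, _, lev, n + 1 => by
      rw [nestedSlice_succ, nestedSliceG_succ, nestedSlice_ctr_eq_nestedSliceG (fine Lc M) (fun k => lev (k + 1)) n, compRows_ctr_eq_compRowsG]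

end Centred


/-! ## §1 Assembly over `Q`, (TB)(TQ) displayed: `lv (c • e_a) s = c · Σ'_m λℤ` -/

section Assembly

variable (Lc : ℕ) [NeZero Lc] (Q : StepRows 3 Lc)
  (hQ : ∀ (M : Fin (3 + 1) → ℕ) [∀ μ, NeZero (M μ)] (ℓ : ℕ) (r : Fin (3 + 1) → ℕ) (a : ↥(pbox M)) (ν : Fin (3 + 1))
      (b : ↥(pbox (fine Lc M))) (κ : Fin (3 + 1)),
      (a : Site (3 + 1)) + unitVec ν ∈ pbox M → Q M ℓ r (a, ν) (b, κ) ≠ 0 →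
        (quo Lc (b : Site (3 + 1)) = a ∨ quo Lc (b : Site (3 + 1)) = (a : Site (3 + 1)) + unitVec ν) ∧
        (quo Lc ((b : Site (3 + 1)) + unitVec κ) = a ∨ quo Lc ((b : Site (3 + 1)) + unitVec κ) = (a : Site (3 + 1)) + unitVec ν))
  (hQt : ∀ (M M' : Fin (3 + 1) → ℕ) [∀ μ, NeZero (M μ)] [∀ μ, NeZero (M' μ)] (ℓ : ℕ) (r : Fin (3 + 1) → ℕ) (v : Site (3 + 1))
      (a : ↥(pbox M)) (a' : ↥(pbox M')) (ν : Fin (3 + 1)) (b : ↥(pbox (fine Lc M))) (b' : ↥(pbox (fine Lc M'))) (κ : Fin (3 + 1)),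
      (a' : Site (3 + 1)) = (a : Site (3 + 1)) + (Lc : ℤ) • v → (b' : Site (3 + 1)) = (b : Site (3 + 1)) + (Lc : ℤ) • ((Lc : ℤ) • v) →
      (a : Site (3 + 1)) + unitVec ν ∈ pbox M → (a' : Site (3 + 1)) + unitVec ν ∈ pbox M' →
        Q M ℓ r (a, ν) (b, κ) = Q M' ℓ r (a', ν) (b', κ))
  (M' : Fin (3 + 1) → ℕ) [∀ μ, NeZero (M' μ)] (lev : ℕ → ℕ) (rs : ℕ → (Fin (3 + 1) → ℕ))
  (hrs : ∀ k i, 0 ≤ toSite (rs k) i ∧ toSite (rs k) i < (Lc : ℤ)) (hM' : ∀ i, Lc ∣ M' i) (n : ℕ)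
include hQ hQt hM'

/-- [folklore] **`hasSum_lamZG_treeGauge_readout`**, over `Q` — at (C6)'s letters on the box `M′` (generic root list; `det ≠ 0` displayed on the box and on the reference tower), the leg letters `hLN hEAN` for an
`L`-block covariant kernel `A` with summable source copies, the coarse box `Mc` (`M′ = Lc • Mc`, so `T = L • Mc`), ONE slot pin `hfa : fN a = (wrapPt T (L•w), inr μ)`, and a displayed (D)-equation for the
data `c • Pi.single a 1`: the `hlve` word of `θ` is the series `Σ'_m −c·λℤ_(μ, translate Mc w m)(↑s)`:
`HasSum (m ↦ c * lamZ … A μ (translate Mc w m) ↑s) (−Σ_x [x.1 = s]·(E *ᵥ θ)(towerEquiv x))`. -/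
theorem hasSum_lamZG_treeGauge_readout
    {Q₁₀ : Matrix (↥(pbox M') × Fin (3 + 1)) (↥(pbox (towerTorus Lc M' (n + 1))) × Fin (3 + 1)) ℝ} (hQ₁₀ : Q₁₀ = compRowsG Lc Q M' lev rs (n + 1))
    {τ₁ : Matrix (NParam Lc (fine Lc M') (fun k => rs (k + 1)) n) (↥(pbox (towerTorus Lc M' (n + 1))) × Fin (3 + 1)) ℝ}
    (hτ₁ : τ₁ = bigP Lc (fine Lc M') (fun k => rs (k + 1)) (fun k => hrs (k + 1)) n)
    {τ₂ : Matrix (Res (toSite (rs 0)) Lc M') (↥(pbox M') × Fin (3 + 1)) ℝ} (hτ₂ : τ₂ = combF Lc M' (rs 0))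
    {N : Matrix (NParam Lc M' rs (n + 1)) (↥(pbox (towerTorus Lc M' (n + 1))) × Fin (3 + 1)) ℝ} (hN : N = Matrix.fromRows (τ₂ * Q₁₀) τ₁)
    {W₀ : Matrix (↥(pbox (towerTorus Lc M' (n + 1))) × Fin (3 + 1)) (NParam Lc M' rs (n + 1)) ℝ} (hW₀ : W₀ = towerGen Lc M' rs (n + 1))
    {E : Matrix (NParam Lc M' rs (n + 1)) (NParam Lc M' rs (n + 1)) ℝ} (hE : E = towerEvalC Lc M' rs hrs (n + 1))
    (hTW : (N * W₀).det ≠ 0)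
    (hTW' : (refSliceG Lc Q lev rs hrs n * towerGen Lc (fun _ : Fin (3 + 1) => Lc) rs (n + 1)).det ≠ 0)
    -- the coarse box and the leg letters for a block-covariant chart with summable source copies
    (Mc : Fin (3 + 1) → ℕ) [∀ i, NeZero (Mc i)] (hMc : ∀ i, M' i = Lc * Mc i)
    {κs ρs : Type*} [Fintype κs] [Fintype ρs] [DecidableEq κs] (ρN : Site (3 + 1)) (LNc : ℕ) (A : MKer (3 + 1) (Fib 3))
    (hA : ∀ t : Site (3 + 1), shiftK (-(((bigRatio Lc (n + 1) : ℕ) : ℤ) • t)) A = A)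
    (hAs : ∀ (x : Site (3 + 1)) (κ μ : Fin (3 + 1)) (w : Site (3 + 1)),
      Summable (fun m : Site (3 + 1) => A x (((bigRatio Lc (n + 1) : ℕ) : ℤ) • translate Mc w m) (Sum.inl κ) (Sum.inr μ)))
    (fN : κs → Idx (towerTorus Lc M' (n + 1)) (Fib 3))
    {XN : Matrix ((↥(pbox (towerTorus Lc M' (n + 1))) × Fin (3 + 1)) ⊕ (κs ⊕ ρs)) ((↥(pbox (towerTorus Lc M' (n + 1))) × Fin (3 + 1)) ⊕ (κs ⊕ ρs)) ℝ}
    (hEAN : perF (towerTorus Lc M' (n + 1)) (axEc ρN LNc) * perF (towerTorus Lc M' (n + 1)) A = perF (towerTorus Lc M' (n + 1)) A)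
    (hLN : XN.submatrix (Sum.map id Sum.inl) (Sum.map id Sum.inl) = fromBlocks
      (Matrix.of fun (b b' : (↥(pbox (towerTorus Lc M' (n + 1))) × Fin (3 + 1))) =>
        axEc ρN LNc (b.1 : Site (3 + 1)) (b.1 : Site (3 + 1)) (Sum.inl b.2) (Sum.inl b.2)
          * (axEc ρN LNc (b'.1 : Site (3 + 1)) (b'.1 : Site (3 + 1)) (Sum.inl b'.2) (Sum.inl b'.2)
            * perF (towerTorus Lc M' (n + 1)) A (b.1, Sum.inl b.2) (b'.1, Sum.inl b'.2)))
      (Matrix.of fun (b : (↥(pbox (towerTorus Lc M' (n + 1))) × Fin (3 + 1))) (a : κs) =>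
        axEc ρN LNc (b.1 : Site (3 + 1)) (b.1 : Site (3 + 1)) (Sum.inl b.2) (Sum.inl b.2) * perF (towerTorus Lc M' (n + 1)) A (b.1, Sum.inl b.2) (fN a))
      (-Matrix.of fun (a : κs) (b : (↥(pbox (towerTorus Lc M' (n + 1))) × Fin (3 + 1))) =>
        axEc ρN LNc (b.1 : Site (3 + 1)) (b.1 : Site (3 + 1)) (Sum.inl b.2) (Sum.inl b.2) * perF (towerTorus Lc M' (n + 1)) A (fN a) (b.1, Sum.inl b.2))
      (-((perF (towerTorus Lc M' (n + 1)) A).submatrix fN fN)))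
    -- ONE slot pin: the source `a` sits at the coarse lattice site `w`, leg `μ`
    (a : κs) (w : Site (3 + 1)) (μ : Fin (3 + 1))
    (hfa : fN a = (wrapPt (towerTorus Lc M' (n + 1)) (((bigRatio Lc (n + 1) : ℕ) : ℤ) • w), Sum.inr μ)) (c : ℝ)
    {θ : NParam Lc M' rs (n + 1) → ℝ}
    (hθ : (N * W₀) *ᵥ θ = -(N *ᵥ (XN.toBlocks₁₂ *ᵥ Sum.elim (c • (Pi.single a (1 : ℝ) : κs → ℝ)) (fun _ : ρs => 0))))
    (s : ↥(pbox (towerTorus Lc M' (n + 1)))) :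
    HasSum (fun m : Site (3 + 1) => c * lamZG Lc Q lev rs hrs n A μ (translate Mc w m) (s : Site (3 + 1)))
      (-(∑ x : Res (bigRoot Lc rs (n + 1)) (bigRatio Lc (n + 1)) (towerTorus Lc M' (n + 1)),
          (if (x.1 : ↥(pbox (towerTorus Lc M' (n + 1)))) = s then (E *ᵥ θ) (towerEquiv Lc M' rs hrs (n + 1) x) else 0))) := by
  have hT : ∀ i, towerTorus Lc M' (n + 1) i = bigRatio Lc (n + 1) * Mc i := fun i => by
    rw [towerTorus_apply, hMc i, bigRatio_eq_pow]; ring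
  -- the copies of the lattice column and their series = the one-shot column of the data
  set Xm : Site (3 + 1) → (↥(pbox (towerTorus Lc M' (n + 1))) × Fin (3 + 1) → ℝ) := fun m b =>
    A (b.1 : Site (3 + 1)) (((bigRatio Lc (n + 1) : ℕ) : ℤ) • translate Mc w m) (Sum.inl b.2) (Sum.inr μ) with hXm
  have hX : HasSum (fun m => c • Xm m) (XN.toBlocks₁₂ *ᵥ Sum.elim (c • (Pi.single a (1 : ℝ) : κs → ℝ)) (fun _ : ρs => 0)) := by
    rw [Pi.hasSum]
    intro b
    rw [toBlocks₁₂_mulVec_smul_single, leg12_of_hLN (towerTorus Lc M' (n + 1)) ρN LNc A fN hLN b a,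
      mask_apply_eq_of_hEA (towerTorus Lc M' (n + 1)) ρN LNc A hEAN (b.1, Sum.inl b.2) (fN a), hfa]
    simp only [Pi.smul_apply, smul_eq_mul, hXm]
    exact (hasSum_perF_inl_source (bigRatio Lc (n + 1)) (towerTorus Lc M' (n + 1)) Mc hT A b.1 b.2 μ w (hAs (b.1 : Site (3 + 1)) b.2 μ w)).mul_left c
  -- the gauge parameter copy by copy, and its read-out
  have hθs := hasSum_gaugeParam hTW hθ hX
  have hr := hasSum_readout E (fun x : Res (bigRoot Lc rs (n + 1)) (bigRatio Lc (n + 1)) (towerTorus Lc M' (n + 1)) => (x.1 : ↥(pbox (towerTorus Lc M' (n + 1)))))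
    (towerEquiv Lc M' rs hrs (n + 1)) s hθs
  -- each copy's read-out is `−c·λℤ`
  have e : ∀ m : Site (3 + 1),
      (∑ x : Res (bigRoot Lc rs (n + 1)) (bigRatio Lc (n + 1)) (towerTorus Lc M' (n + 1)),
        (if (x.1 : ↥(pbox (towerTorus Lc M' (n + 1)))) = s then (E *ᵥ (-((N * W₀)⁻¹ *ᵥ (N *ᵥ (c • Xm m))))) (towerEquiv Lc M' rs hrs (n + 1) x) else 0))
        = -(c * lamZG Lc Q lev rs hrs n A μ (translate Mc w m) (s : Site (3 + 1))) := by
    intro m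
    rw [neg_inv_mulVec_smul, readout_smul, treeGauge_readout_eq_neg_lamZG Lc Q hQ hQt M' lev rs hrs hM' n hQ₁₀ hτ₁ hτ₂ hN hW₀ hE hTW hTW' A hA μ (translate Mc w m)
      (mul_mulVec_neg_inv hTW (Xm m)) s, mul_neg]
  simp_rw [e] at hr
  simpa using hr.neg

/-- [folklore] **`lv_smul_single_eq_tsum_lamZG`**, over `Q` — the same with v10's `hlve`-shaped DISPLAY of the tree-gauge function (`lv v s = −Σ_x [x.1 = s]·(E *ᵥ θ_v)(towerEquiv x)` for the displayed `θ_v`):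
`lv (c • Pi.single a 1) s = c * Σ'_m lamZ … A μ (translate Mc w m) ↑s`. -/
theorem lv_smul_single_eq_tsum_lamZG
    {Q₁₀ : Matrix (↥(pbox M') × Fin (3 + 1)) (↥(pbox (towerTorus Lc M' (n + 1))) × Fin (3 + 1)) ℝ} (hQ₁₀ : Q₁₀ = compRowsG Lc Q M' lev rs (n + 1))
    {τ₁ : Matrix (NParam Lc (fine Lc M') (fun k => rs (k + 1)) n) (↥(pbox (towerTorus Lc M' (n + 1))) × Fin (3 + 1)) ℝ}
    (hτ₁ : τ₁ = bigP Lc (fine Lc M') (fun k => rs (k + 1)) (fun k => hrs (k + 1)) n)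
    {τ₂ : Matrix (Res (toSite (rs 0)) Lc M') (↥(pbox M') × Fin (3 + 1)) ℝ} (hτ₂ : τ₂ = combF Lc M' (rs 0))
    {N : Matrix (NParam Lc M' rs (n + 1)) (↥(pbox (towerTorus Lc M' (n + 1))) × Fin (3 + 1)) ℝ} (hN : N = Matrix.fromRows (τ₂ * Q₁₀) τ₁)
    {W₀ : Matrix (↥(pbox (towerTorus Lc M' (n + 1))) × Fin (3 + 1)) (NParam Lc M' rs (n + 1)) ℝ} (hW₀ : W₀ = towerGen Lc M' rs (n + 1))
    (hTW : (N * W₀).det ≠ 0)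
    (hTW' : (refSliceG Lc Q lev rs hrs n * towerGen Lc (fun _ : Fin (3 + 1) => Lc) rs (n + 1)).det ≠ 0)
    (Mc : Fin (3 + 1) → ℕ) [∀ i, NeZero (Mc i)] (hMc : ∀ i, M' i = Lc * Mc i)
    {κs ρs : Type*} [Fintype κs] [Fintype ρs] [DecidableEq κs] (ρN : Site (3 + 1)) (LNc : ℕ) (A : MKer (3 + 1) (Fib 3))
    (hA : ∀ t : Site (3 + 1), shiftK (-(((bigRatio Lc (n + 1) : ℕ) : ℤ) • t)) A = A)
    (hAs : ∀ (x : Site (3 + 1)) (κ μ : Fin (3 + 1)) (w : Site (3 + 1)),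
      Summable (fun m : Site (3 + 1) => A x (((bigRatio Lc (n + 1) : ℕ) : ℤ) • translate Mc w m) (Sum.inl κ) (Sum.inr μ)))
    (fN : κs → Idx (towerTorus Lc M' (n + 1)) (Fib 3))
    {XN : Matrix ((↥(pbox (towerTorus Lc M' (n + 1))) × Fin (3 + 1)) ⊕ (κs ⊕ ρs)) ((↥(pbox (towerTorus Lc M' (n + 1))) × Fin (3 + 1)) ⊕ (κs ⊕ ρs)) ℝ}
    (hEAN : perF (towerTorus Lc M' (n + 1)) (axEc ρN LNc) * perF (towerTorus Lc M' (n + 1)) A = perF (towerTorus Lc M' (n + 1)) A)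
    (hLN : XN.submatrix (Sum.map id Sum.inl) (Sum.map id Sum.inl) = fromBlocks
      (Matrix.of fun (b b' : (↥(pbox (towerTorus Lc M' (n + 1))) × Fin (3 + 1))) =>
        axEc ρN LNc (b.1 : Site (3 + 1)) (b.1 : Site (3 + 1)) (Sum.inl b.2) (Sum.inl b.2)
          * (axEc ρN LNc (b'.1 : Site (3 + 1)) (b'.1 : Site (3 + 1)) (Sum.inl b'.2) (Sum.inl b'.2)
            * perF (towerTorus Lc M' (n + 1)) A (b.1, Sum.inl b.2) (b'.1, Sum.inl b'.2)))
      (Matrix.of fun (b : (↥(pbox (towerTorus Lc M' (n + 1))) × Fin (3 + 1))) (a : κs) =>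
        axEc ρN LNc (b.1 : Site (3 + 1)) (b.1 : Site (3 + 1)) (Sum.inl b.2) (Sum.inl b.2) * perF (towerTorus Lc M' (n + 1)) A (b.1, Sum.inl b.2) (fN a))
      (-Matrix.of fun (a : κs) (b : (↥(pbox (towerTorus Lc M' (n + 1))) × Fin (3 + 1))) =>
        axEc ρN LNc (b.1 : Site (3 + 1)) (b.1 : Site (3 + 1)) (Sum.inl b.2) (Sum.inl b.2) * perF (towerTorus Lc M' (n + 1)) A (fN a) (b.1, Sum.inl b.2))
      (-((perF (towerTorus Lc M' (n + 1)) A).submatrix fN fN)))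
    (a : κs) (w : Site (3 + 1)) (μ : Fin (3 + 1))
    (hfa : fN a = (wrapPt (towerTorus Lc M' (n + 1)) (((bigRatio Lc (n + 1) : ℕ) : ℤ) • w), Sum.inr μ)) (c : ℝ)
    -- the displayed gauge parameter of the data and v10's `hlve`-shaped read-out
    (θv : (κs → ℝ) → (NParam Lc M' rs (n + 1) → ℝ))
    (hθ : (N * W₀) *ᵥ θv (c • (Pi.single a (1 : ℝ) : κs → ℝ)) = -(N *ᵥ (XN.toBlocks₁₂ *ᵥ Sum.elim (c • (Pi.single a (1 : ℝ) : κs → ℝ)) (fun _ : ρs => 0))))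
    (lv : (κs → ℝ) → (↥(pbox (towerTorus Lc M' (n + 1))) → ℝ))
    (hlve : ∀ (v : κs → ℝ) (s : ↥(pbox (towerTorus Lc M' (n + 1)))), lv v s
      = -(∑ x : Res (bigRoot Lc rs (n + 1)) (bigRatio Lc (n + 1)) (towerTorus Lc M' (n + 1)),
          (if (x.1 : ↥(pbox (towerTorus Lc M' (n + 1)))) = s then
            (towerEvalC Lc M' rs hrs (n + 1) *ᵥ θv v) (towerEquiv Lc M' rs hrs (n + 1) x) else 0)))
    (s : ↥(pbox (towerTorus Lc M' (n + 1)))) :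
    lv (c • (Pi.single a (1 : ℝ) : κs → ℝ)) s = c * ∑' m : Site (3 + 1), lamZG Lc Q lev rs hrs n A μ (translate Mc w m) (s : Site (3 + 1)) := by
  rw [hlve, ← tsum_mul_left]
  exact ((hasSum_lamZG_treeGauge_readout Lc Q hQ hQt M' lev rs hrs hM' n hQ₁₀ hτ₁ hτ₂ hN hW₀ rfl hTW hTW' Mc hMc ρN LNc A hA hAs fN hEAN hLN a w μ hfa c hθ s).tsum_eq).symm

end Assembly

/-! ## §2 At v11's ROOTED pins, for the record's chart `σ·AN·σ`: STUB P (P-c) with W-8 R-1's row texts -/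

section Rooted

variable {Lc : ℕ} [NeZero Lc] (R : Roots Lc)
variable (M' : Fin (3 + 1) → ℕ) [∀ μ, NeZero (M' μ)] (Lc) (lev : ℕ → ℕ) (n : ℕ)

set_option synthInstance.maxSize 1024 in
/-- [folklore] **`lv_smul_single_eq_tsum_lamZG_at_pins_rooted` — STUB P (P-c) AT v11's ROOTED PINS: THE DOOR's GAUGE FUNCTION IS THE PERIODISED ROOTED LATTICE GAUGE FUNCTION.**  Binders =
PART 57 `lv_smul_single_eq_tsum_lamZ_at_pins`'s with `hQ₁₀ ∕ hQ₂₀` replaced by W-8 R-1's rooted texts (`compRows …`, `bhKStepAt 3 (toSite (ctrOff (3+1) Lc)) Lc (lev 0)` slot rows), EVERY other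
binder (incl. the sym-spelled `hH₀`, the displayed `h1 h2 hTW`, the leg letters, the pin, `hlve`) CHARACTER FOR CHARACTER; conclusion:
`lv (c • Pi.single a 1) s = c * Σ'_m lamZG Lc (fun M _ ℓ _ => Qstep Lc M ℓ (ctrOff 4 Lc)) lev ρc∗ ρc∈ n (scaleK σ σ (AN R (n+1))) μ (translate Mc w m) ↑s`.  Inside: the (D)-equation by road
`nestedSlice_mul_gaugeParam_eq_neg` over `XN_toBlocks₁₂_mulVec_eq_gaugeProj_G` at the centred rooted family, its brick inputs by the road's v5-era rooted record; (TB)(TQ) by PART 80; the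
reference G-2 by PART 81 `det_refSliceG_ctr_mul_towerGen_ne_zero`. -/
theorem lv_smul_single_eq_tsum_lamZG_at_pins_rooted
    (hrs : ∀ _k : ℕ, ctrOff (3 + 1) Lc ∈ box (3 + 1) Lc)
    (hlev : ∀ i, i ≤ n → lev i = lev (i + 1) + 1) (hM' : ∀ i, Lc ∣ M' i)
    {κ : Type*} [Fintype κ] [DecidableEq κ] (pμ' : κ → ↥(pbox M')) (mμ' : κ → Fin (3 + 1))
    (hfμ' : Function.Injective (fun a : κ => ((pμ' a, Sum.inr (mμ' a)) : Idx M' (Fib 3))))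
    (hcoarse' : ∀ (s : ↥(pbox M')) (m : Fin (3 + 1)),
      ((s, Sum.inr m) : Idx M' (Fib 3)) ∈ Set.range (fun a : κ => ((pμ' a, Sum.inr (mμ' a)) : Idx M' (Fib 3))) ↔ Torus.proj Lc (s : Site (3 + 1)) = 0)
    {H₀ : Matrix (↥(pbox (towerTorus Lc M' (n + 1))) × Fin (3 + 1)) (↥(pbox (towerTorus Lc M' (n + 1))) × Fin (3 + 1)) ℝ}
    {Q₁₀ : Matrix (↥(pbox M') × Fin (3 + 1)) (↥(pbox (towerTorus Lc M' (n + 1))) × Fin (3 + 1)) ℝ}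
    {τ₁ : Matrix (NParam Lc (fine Lc M') (fun k => (fun _ : ℕ => ctrOff (3 + 1) Lc) (k + 1)) n) (↥(pbox (towerTorus Lc M' (n + 1))) × Fin (3 + 1)) ℝ}
    (hH₀ : H₀ = (perF (towerTorus Lc M' (n + 1)) (bhKStepSh 3 Lc (Dsh Lc) (lev (n + 1)))).submatrix
        (fun b : ↥(pbox (towerTorus Lc M' (n + 1))) × Fin (3 + 1) => ((b.1, Sum.inl b.2) : Idx (towerTorus Lc M' (n + 1)) (Fib 3)))
        (fun b : ↥(pbox (towerTorus Lc M' (n + 1))) × Fin (3 + 1) => ((b.1, Sum.inl b.2) : Idx (towerTorus Lc M' (n + 1)) (Fib 3))))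
    (hQ₁₀ : Q₁₀ = compRows Lc M' lev (fun _ : ℕ => ctrOff (3 + 1) Lc) (n + 1))
    (hτ₁ : τ₁ = bigP Lc (fine Lc M') (fun k => (fun _ : ℕ => ctrOff (3 + 1) Lc) (k + 1)) (fun k => toSite_mem_range (hrs (k + 1))) n)
    {τ₂ : Matrix (Res (toSite (ctrOff (3 + 1) Lc)) Lc M') (↥(pbox M') × Fin (3 + 1)) ℝ} (hτ₂ : τ₂ = combF Lc M' ((fun _ : ℕ => ctrOff (3 + 1) Lc) 0))
    {Q₂₀ : Matrix κ (↥(pbox M') × Fin (3 + 1)) ℝ}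
    (hQ₂₀ : Q₂₀ = (perF M' (bhKStepAt 3 (toSite (ctrOff (3 + 1) Lc)) Lc (lev 0))).submatrix (fun a : κ => ((pμ' a, Sum.inr (mμ' a)) : Idx M' (Fib 3)))
        (fun b : ↥(pbox M') × Fin (3 + 1) => ((b.1, Sum.inl b.2) : Idx M' (Fib 3))))
    {W₀ : Matrix (↥(pbox (towerTorus Lc M' (n + 1))) × Fin (3 + 1)) (NParam Lc M' (fun _ : ℕ => ctrOff (3 + 1) Lc) (n + 1)) ℝ}
    (hW₀ : W₀ = towerGen Lc M' (fun _ : ℕ => ctrOff (3 + 1) Lc) (n + 1))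
    {P : Matrix (NParam Lc M' (fun _ : ℕ => ctrOff (3 + 1) Lc) (n + 1)) (↥(pbox (towerTorus Lc M' (n + 1))) × Fin (3 + 1)) ℝ}
    (hP : P = bigP Lc M' (fun _ : ℕ => ctrOff (3 + 1) Lc) (fun k => toSite_mem_range (hrs k)) (n + 1))
    {𝔔₀ : Matrix κ (↥(pbox (towerTorus Lc M' (n + 1))) × Fin (3 + 1)) ℝ} (h𝔔₀ : Q₂₀ * Q₁₀ = 𝔔₀)
    {I : Matrix (↥(pbox (towerTorus Lc M' (n + 1))) × Fin (3 + 1))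
      ((↥(pbox M') × Fin (3 + 1)) ⊕ NParam Lc (fine Lc M') (fun k => (fun _ : ℕ => ctrOff (3 + 1) Lc) (k + 1)) n) ℝ}
    {S : Matrix ((↥(pbox M') × Fin (3 + 1)) ⊕ NParam Lc (fine Lc M') (fun k => (fun _ : ℕ => ctrOff (3 + 1) Lc) (k + 1)) n)
      ((↥(pbox M') × Fin (3 + 1)) ⊕ NParam Lc (fine Lc M') (fun k => (fun _ : ℕ => ctrOff (3 + 1) Lc) (k + 1)) n) ℝ}
    (hI : minOp H₀ (fromRows Q₁₀ τ₁) = I) (hS : effForm H₀ (fromRows Q₁₀ τ₁) = S)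
    {hv : (κ → ℝ) → ((↥(pbox (towerTorus Lc M' (n + 1))) × Fin (3 + 1)) → ℝ)}
    (hhv : ∀ v, hv v = I *ᵥ Sum.elim (minOp S.toBlocks₁₁ (fromRows Q₂₀ τ₂) *ᵥ Sum.elim v 0) 0)
    {XN : Matrix ((↥(pbox (towerTorus Lc M' (n + 1))) × Fin (3 + 1)) ⊕ (κ ⊕ NParam Lc M' (fun _ : ℕ => ctrOff (3 + 1) Lc) (n + 1)))
      ((↥(pbox (towerTorus Lc M' (n + 1))) × Fin (3 + 1)) ⊕ (κ ⊕ NParam Lc M' (fun _ : ℕ => ctrOff (3 + 1) Lc) (n + 1))) ℝ}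
    (hXN : kkt H₀ (fromRows 𝔔₀ P) * XN = 1) 
    -- the two KKT non-degeneracies of the NESTED system (displayed; at the wrapper `h1` is `Matrix.isUnit_det_of_right_inverse` on the F leg `hXF`, `h2` is #21-GB's (EFF) line)
    (h1 : (kkt H₀ (fromRows Q₁₀ τ₁)).det ≠ 0) (h2 : (kkt S.toBlocks₁₁ (fromRows Q₂₀ τ₂)).det ≠ 0)
    (hTW : (Matrix.fromRows (τ₂ * Q₁₀) τ₁ * W₀).det ≠ 0)
    -- the coarse box and the leg letters for the record's chart
    (Mc : Fin (3 + 1) → ℕ) [∀ i, NeZero (Mc i)] (hMc : ∀ i, M' i = Lc * Mc i)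
    (σ : Fib 3 → ℝ) (ρN : Site (3 + 1)) (LNc : ℕ) (fN : κ → Idx (towerTorus Lc M' (n + 1)) (Fib 3))
    (hEAN : perF (towerTorus Lc M' (n + 1)) (axEc ρN LNc) * perF (towerTorus Lc M' (n + 1)) (scaleK σ σ (AN R (n + 1))) = perF (towerTorus Lc M' (n + 1)) (scaleK σ σ (AN R (n + 1))))
    (hLN : XN.submatrix (Sum.map id Sum.inl) (Sum.map id Sum.inl) = fromBlocks
      (Matrix.of fun (b b' : (↥(pbox (towerTorus Lc M' (n + 1))) × Fin (3 + 1))) =>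
        axEc ρN LNc (b.1 : Site (3 + 1)) (b.1 : Site (3 + 1)) (Sum.inl b.2) (Sum.inl b.2)
          * (axEc ρN LNc (b'.1 : Site (3 + 1)) (b'.1 : Site (3 + 1)) (Sum.inl b'.2) (Sum.inl b'.2)
            * perF (towerTorus Lc M' (n + 1)) (scaleK σ σ (AN R (n + 1))) (b.1, Sum.inl b.2) (b'.1, Sum.inl b'.2)))
      (Matrix.of fun (b : (↥(pbox (towerTorus Lc M' (n + 1))) × Fin (3 + 1))) (a : κ) =>
        axEc ρN LNc (b.1 : Site (3 + 1)) (b.1 : Site (3 + 1)) (Sum.inl b.2) (Sum.inl b.2) * perF (towerTorus Lc M' (n + 1)) (scaleK σ σ (AN R (n + 1))) (b.1, Sum.inl b.2) (fN a))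
      (-Matrix.of fun (a : κ) (b : (↥(pbox (towerTorus Lc M' (n + 1))) × Fin (3 + 1))) =>
        axEc ρN LNc (b.1 : Site (3 + 1)) (b.1 : Site (3 + 1)) (Sum.inl b.2) (Sum.inl b.2) * perF (towerTorus Lc M' (n + 1)) (scaleK σ σ (AN R (n + 1))) (fN a) (b.1, Sum.inl b.2))
      (-((perF (towerTorus Lc M' (n + 1)) (scaleK σ σ (AN R (n + 1)))).submatrix fN fN)))
    -- ONE slot pin (v10: `hfN n B a` with `w = ↑a.1`, `μ = a.2`)
    (a : κ) (w : Site (3 + 1)) (μ : Fin (3 + 1))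
    (hfa : fN a = (wrapPt (towerTorus Lc M' (n + 1)) (((Lc ^ (n + 1 + 1) : ℕ) : ℤ) • w), Sum.inr μ)) (c : ℝ)
    -- v10's `hlve`-shaped DISPLAY of the tree-gauge function
    (lv : (κ → ℝ) → (↥(pbox (towerTorus Lc M' (n + 1))) → ℝ))
    (hlve : ∀ (v : κ → ℝ) (s : ↥(pbox (towerTorus Lc M' (n + 1)))), lv v s
      = -(∑ x : Res (bigRoot Lc (fun _ : ℕ => ctrOff (3 + 1) Lc) (n + 1)) (bigRatio Lc (n + 1)) (towerTorus Lc M' (n + 1)),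
          (if (x.1 : ↥(pbox (towerTorus Lc M' (n + 1)))) = s then
            (towerEvalC Lc M' (fun _ : ℕ => ctrOff (3 + 1) Lc) (fun k => toSite_mem_range (hrs k)) (n + 1)
              *ᵥ ((P * W₀)⁻¹ *ᵥ (P *ᵥ hv v))) (towerEquiv Lc M' (fun _ : ℕ => ctrOff (3 + 1) Lc) (fun k => toSite_mem_range (hrs k)) (n + 1) x) else 0)))
    (s : ↥(pbox (towerTorus Lc M' (n + 1)))) :
    lv (c • (Pi.single a (1 : ℝ) : κ → ℝ)) s
      = c * ∑' m : Site (3 + 1), lamZG Lc (fun (M : Fin (3 + 1) → ℕ) (_ : ∀ μ, NeZero (M μ)) (ℓ : ℕ) (_ : Fin (3 + 1) → ℕ) => Qstep Lc M ℓ (ctrOff (3 + 1) Lc))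
          lev (fun _ : ℕ => ctrOff (3 + 1) Lc) (fun k => toSite_mem_range (hrs k)) n (scaleK σ σ (AN R (n + 1))) μ
          (translate Mc w m) (s : Site (3 + 1)) := by
  have hc : ctrOff (3 + 1) Lc ∈ box (3 + 1) Lc := hrs 0
  -- the finest form's display, rooted spelling (the ff block sees neither the root nor `Dsh`)
  have hH₀' : H₀ = (perF (towerTorus Lc M' (n + 1)) (bhKStepAt 3 (toSite (ctrOff (3 + 1) Lc)) Lc (lev (n + 1)))).submatrix
      (fun b : ↥(pbox (towerTorus Lc M' (n + 1))) × Fin (3 + 1) => ((b.1, Sum.inl b.2) : Idx (towerTorus Lc M' (n + 1)) (Fib 3)))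
      (fun b : ↥(pbox (towerTorus Lc M' (n + 1))) × Fin (3 + 1) => ((b.1, Sum.inl b.2) : Idx (towerTorus Lc M' (n + 1)) (Fib 3))) := by
    rw [hH₀]; ext p q
    simp only [Matrix.submatrix_apply, perF_apply, perZ_apply]
    exact tsum_congr fun m => bhKStepSh_Dsh_inl_inl_eq_bhKStepAt Lc (toSite (ctrOff (3 + 1) Lc)) (lev (n + 1)) _ _ _ _
  -- the composite covariance row `c0` at the rooted rows, BEFORE the generic re-spelling of `hQ₁₀`
  have c0 : Q₁₀ * W₀ = Matrix.fromCols
      ((∏ i ∈ range (n + 1), (stepScale 3 Lc (lev (i + 1)) * ((box (3 + 1) Lc).card : ℝ))) •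
        (tgrad M').submatrix (fun a : ↥(pbox M') × Fin (3 + 1) => ((a.1, Sum.inl a.2) : Idx M' (Fib 3)))
          (fun t : Res (toSite (ctrOff (3 + 1) Lc)) Lc M' => (t.1 : ↥(pbox M'))))
      (0 : Matrix (↥(pbox M') × Fin (3 + 1)) (NParam Lc (fine Lc M') (fun k => (fun _ : ℕ => ctrOff (3 + 1) Lc) (k + 1)) n) ℝ) := by
    rw [hQ₁₀, hW₀]
    exact compRows_mul_towerGen_succ Lc n M' lev (fun _ : ℕ => ctrOff (3 + 1) Lc) hrs
  have hTW₀ : (Matrix.fromRows (τ₂ * Q₁₀) τ₁ * W₀).det ≠ 0 :=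
    torus_hTW_oneShot_tower M' Lc lev (fun _ : ℕ => ctrOff (3 + 1) Lc) n hrs hM' hQ₁₀ hτ₁ hτ₂ hW₀
  have hQ₁₀G := hQ₁₀
  rw [compRows_ctr_eq_compRowsG] at hQ₁₀G
  -- the gauge parameter's (D)-equation at the rooted pins
  have hθ : ∀ v, (Matrix.fromRows (τ₂ * Q₁₀) τ₁ * W₀) *ᵥ ((P * W₀)⁻¹ *ᵥ (P *ᵥ hv v))
      = -(Matrix.fromRows (τ₂ * Q₁₀) τ₁ *ᵥ (XN.toBlocks₁₂ *ᵥ Sum.elim v 0)) := fun v =>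
    nestedSlice_mul_gaugeParam_eq_neg hI hhv
      (fun w => XN_toBlocks₁₂_mulVec_eq_gaugeProj_G M' Lc lev (fun _ : ℕ => ctrOff (3 + 1) Lc) n
        (fun (M : Fin (3 + 1) → ℕ) (_ : ∀ μ, NeZero (M μ)) (ℓ : ℕ) (_ : Fin (3 + 1) → ℕ) => Qstep Lc M ℓ (ctrOff (3 + 1) Lc))
        (fun ℓ r => bhKStepAt 3 (toSite r) Lc ℓ) hrs hlev hM' hH₀' hQ₁₀G hτ₁
        (H₀_transpose_of_dvd (dvd_towerTorus_succ (Lc := Lc) M' n) (lev (n + 1)) hH₀')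
        (fun k T _ => torus_h1 T (hrs k) (lev k))
        (fun k T _ r' => hId_order_zero_record T (hrs k) (lev k) r' (coarsePt T Lc) (coarsePt_coe T Lc) (coarseSlot_injective T) (coarseSlot_range T))
        (by
          rw [← nestedSlice_ctr_eq_nestedSliceG]
          exact det_nestedSlice_mul_towerGen_ne_zero Lc n (fine Lc M') (fun k => lev (k + 1)) (fun _ => ctrOff (3 + 1) Lc) (fun k => hrs (k + 1)) (dvd_fine M'))
        Q₂₀
        (by
          rw [hQ₂₀, hτ₂]
          exact (torus_isUnit_det_kkt_combRows M' (hrs 0) hM' (lev 0) _ hfμ' (fun a => ⟨mμ' a, rfl⟩) hcoarse').ne_zero)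
        hW₀ hP c0 hTW₀
        (by rw [hQ₂₀]; exact Qtop_mul_smul_tgrad_res Lc M' (hrs 0) hM' (lev 0) _ pμ' mμ')
        (torus_a0_tower Lc M' lev (fun _ : ℕ => ctrOff (3 + 1) Lc) n hrs hH₀' hW₀)
        h𝔔₀ hI hS hhv hXN w)
      h1 h2 v
  have hLb : ((bigRatio Lc (n + 1) : ℕ) : ℤ) = ((Lc ^ (n + 1 + 1) : ℕ) : ℤ) := by rw [bigRatio_eq_pow]
  have hA : ∀ t : Site (3 + 1), shiftK (-(((bigRatio Lc (n + 1) : ℕ) : ℤ) • t)) (scaleK σ σ (AN R (n + 1))) = scaleK σ σ (AN R (n + 1)) := fun t => by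
    rw [hLb]; exact shiftK_scaleK_AN R (n + 1) σ σ t
  have hAs : ∀ (x : Site (3 + 1)) (κ' μ' : Fin (3 + 1)) (w' : Site (3 + 1)),
      Summable (fun m : Site (3 + 1) => scaleK σ σ (AN R (n + 1)) x (((bigRatio Lc (n + 1) : ℕ) : ℤ) • translate Mc w' m) (Sum.inl κ') (Sum.inr μ')) :=
    fun x κ' μ' w' => by rw [hLb]; exact summable_scaleK_AN_inl_inr_copies R (n + 1) σ σ Mc x κ' μ' w'
  have hfa' : fN a = (wrapPt (towerTorus Lc M' (n + 1)) (((bigRatio Lc (n + 1) : ℕ) : ℤ) • w), Sum.inr μ) := by rw [hLb]; exact hfa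
  exact lv_smul_single_eq_tsum_lamZG Lc (fun (M : Fin (3 + 1) → ℕ) (_ : ∀ μ, NeZero (M μ)) (ℓ : ℕ) (_ : Fin (3 + 1) → ℕ) => Qstep Lc M ℓ (ctrOff (3 + 1) Lc))
    (QCtr_twoBlock Lc) (QCtr_blockTranslate Lc) M' lev (fun _ : ℕ => ctrOff (3 + 1) Lc) (fun k => toSite_mem_range (hrs k)) hM' n hQ₁₀G hτ₁ hτ₂ rfl hW₀ hTW
    (det_refSliceG_ctr_mul_towerGen_ne_zero Lc lev n (hrs 0)) Mc hMc ρN LNc (scaleK σ σ (AN R (n + 1))) hA hAs fN hEAN hLN a w μ hfa' c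
    (fun v => (P * W₀)⁻¹ *ᵥ (P *ᵥ hv v)) (hθ (c • (Pi.single a (1 : ℝ) : κ → ℝ))) lv hlve s

end Rooted

end Summit.QuantumFields.BalabanUV.Beta.FP.TowerDoorGaugePeriodisedG

end
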